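import Literature.InformationTheory.QuantumCodes.TwistedToricHomology
import Literature.InformationTheory.QuantumCodes.OptimalRadius
import HarnessLib

/-!
# Toric codes on twisted tori — `d = sys₁(Λ)`: the twisted toric code is `[[2|G|, 2, sys₁(Λ)]]`

Topic `InformationTheory/QuantumCodes`; namespace `Literature.InformationTheory.QuantumCodes.TwistedToric`.
LADDER-QEC (cell `qec`), PARTITION row 08, item 08.TWIST (file 6, the assembly, of the distance proof of
`TwistedToricCodes.lean`).

**Main theorem (`code_isCode`).** For every finite abelian group `G` and `g₁, g₂` generating `G`, the abelian
two-block code `LP[1 + x^{g₁}, 1 + x^{g₂}]` — Kitaev's toric code on the twisted torus `ℤ²/Λ`,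
`Λ = {m : m₁•g₁ + m₂•g₂ = 0}` — is an `[[2|G|, 2, sys₁(Λ)]]` code, `sys₁(Λ) = min{|m₁|+|m₂| : m ∈ Λ∖0}`; both sector
distances equal `sys₁(Λ)` (`code_dZ`, `code_dX`), and the optimal correction radius is `⌊(sys₁(Λ)−1)/2⌋` for
every sector decoder (`code_minWeight_correctsUpTo`, `code_radius_optimal`). This is the distance formula `d(L₁,L₂) = min_m ‖m₁L₁+m₂L₂‖` of
Kovalev–Pryadko (ISIT 2012 §III.C — stated there «it is easy to see», in checkerboard coordinates where the norm
reads `‖·‖_∞`; here in edge coordinates, `‖·‖₁`), an instance of the homological-code theorem «distance = minimal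
weight of a non-trivial (co)cycle» (Bombin–Martin-Delgado 2007 Thm 3.2) made explicit for the square cellulations
of all twisted tori. Instances: the `L × L` toric code (`Λ = Lℤ²`), the cyclic «rotated toric» GB codes
`[[2t²+2(t+1)², 2, 2t+1]]` (KP13 Ex. 2), the hyperbicycle rows `[[40,2,6]]`, `[[90,2,9]]`, `[[104,2,10]]` (KP13 Ex. 7).

Upper bound (this file): a Hermite basis `(a,0), (b,c)` of `Λ` (`aPer`, `bPer`, `cPer`), the parity obstruction
(a shortest period has an odd Hermite coordinate), and the **carry cocycle** `coc` = coboundary of `p ↦ ⌊⟨w,p⟩/M⌋`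
for a dual functional `w/M` of `Λ`, pushed down to `G`: it lies in `ker H_Z` and pairs to `1` with the staircase loop
of a shortest period. Lower bound: `TwistedToricHomology.lean`; `k = 2`: `TwistedToricCodes.lean`; `d_X = d_Z`: the
tree's `AbelianTwoBlock.css_dX_eq_dZ`. 0 named facts, no instances, no notation; axioms standard.
References (locators read on the page; qec-lit-3's lit/TWIST-LOCATORS.md): [KovalevPryadko2012] arXiv:1202.0928
§III.C p0005 L52-80 (statement «it is easy to see … d(L₁,L₂) = min ‖m₁L₁+m₂L₂‖_∞», no printed proof);
[KovalevPryadko2013Hyperbicycle] arXiv:1212.6703 Ex. 2 (p0008 L11-15), Ex. 7 (p0016 L18-24); [BombinMartinDelgado2007]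
J. Math. Phys. 48 (2007) 052105 = arXiv:quant-ph/0605094 §III Thm. 3.2 (p0018 L86-99, proof L101-118: `d = d(Σ)`);
[DennisEtAl2002] §3.1 (the untwisted torus).
-/

namespace Literature.InformationTheory.QuantumCodes

open Matrix Finset

namespace TwistedToric

section Hermite

variable {G : Type*} [AddCommGroup G] [Fintype G] (g₁ g₂ : G)

/-- Some positive horizontal period `(a, 0)` exists (`a = |G|`).
[cite: KovalevPryadko2012, §III.C (p0005 L53-60: the period lattice has finite index)] -/
theorem exists_hPeriod : ∃ a : ℕ, 0 < a ∧ IsPeriod g₁ g₂ ((a : ℤ), 0) :=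
  ⟨Fintype.card G, Fintype.card_pos, isPeriod_card g₁ g₂⟩

/-- Some period `(b, c)` with `c > 0` exists (`(0, |G|)`).
[cite: KovalevPryadko2012, §III.C (p0005 L53-60)] -/
theorem exists_vPeriod : ∃ c : ℕ, 0 < c ∧ ∃ b : ℤ, IsPeriod g₁ g₂ (b, (c : ℤ)) :=
  ⟨Fintype.card G, Fintype.card_pos, 0, by simp [IsPeriod, natCast_zsmul]⟩

open Classical in
/-- `a`: the least positive `a` with `(a, 0) ∈ Λ` (first Hermite basis vector `(a,0)`). (definition)
[cite: KovalevPryadko2012, §III.C (p0005 L69-72: equivalent periodicity vectors L'ᵢ = gᵢⱼLⱼ, det g = ±1 — change of lattice basis)] -/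
noncomputable def aPer : ℕ := Nat.find (exists_hPeriod g₁ g₂)

open Classical in
/-- `c`: the least positive second coordinate of a period (second Hermite basis vector `(b, c)`). (definition)
[cite: KovalevPryadko2012, §III.C (p0005 L69-72)] -/
noncomputable def cPer : ℕ := Nat.find (exists_vPeriod g₁ g₂)

open Classical in
/-- `a > 0` and `(a, 0)` is a period. [cite: KovalevPryadko2012, §III.C (p0005 L69-72)] -/
theorem aPer_spec : 0 < aPer g₁ g₂ ∧ IsPeriod g₁ g₂ ((aPer g₁ g₂ : ℤ), 0) := Nat.find_spec (exists_hPeriod g₁ g₂)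

open Classical in
/-- Minimality of `a`. [cite: KovalevPryadko2012, §III.C (p0005 L69-72)] -/
theorem aPer_min {a' : ℕ} (h0 : 0 < a') (h : IsPeriod g₁ g₂ ((a' : ℤ), 0)) : aPer g₁ g₂ ≤ a' :=
  Nat.find_min' _ ⟨h0, h⟩

open Classical in
/-- `c > 0` and some `(b, c)` is a period. [cite: KovalevPryadko2012, §III.C (p0005 L69-72)] -/
theorem cPer_spec : 0 < cPer g₁ g₂ ∧ ∃ b : ℤ, IsPeriod g₁ g₂ (b, (cPer g₁ g₂ : ℤ)) := Nat.find_spec (exists_vPeriod g₁ g₂)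

open Classical in
/-- Minimality of `c`. [cite: KovalevPryadko2012, §III.C (p0005 L69-72)] -/
theorem cPer_min {c' : ℕ} (h0 : 0 < c') (h : ∃ b : ℤ, IsPeriod g₁ g₂ (b, (c' : ℤ))) : cPer g₁ g₂ ≤ c' :=
  Nat.find_min' _ ⟨h0, h⟩

/-- `b`: a first coordinate making `(b, c)` a period. (definition) [cite: KovalevPryadko2012, §III.C (p0005 L69-72)] -/
noncomputable def bPer : ℤ := Classical.choose (cPer_spec g₁ g₂).2

/-- `(b, c)` is a period. [cite: KovalevPryadko2012, §III.C (p0005 L69-72)] -/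
theorem bcPer_isPeriod : IsPeriod g₁ g₂ (bPer g₁ g₂, (cPer g₁ g₂ : ℤ)) := Classical.choose_spec (cPer_spec g₁ g₂).2

/-- Every horizontal period is a multiple of `(a, 0)`: `(x, 0) ∈ Λ ⇒ a ∣ x` (Euclidean division + minimality).
[cite: KovalevPryadko2012, §III.C (p0005 L69-72: lattice basis change)] -/
theorem aPer_dvd {x : ℤ} (hx : IsPeriod g₁ g₂ (x, 0)) : (aPer g₁ g₂ : ℤ) ∣ x := by
  obtain ⟨ha, hap⟩ := aPer_spec g₁ g₂
  set a : ℤ := (aPer g₁ g₂ : ℤ) with ha'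
  have ha0 : (0 : ℤ) < a := by rw [ha']; exact_mod_cast ha
  have hr : IsPeriod g₁ g₂ (x % a, 0) := by
    have h := hx.sub (hap.zsmul (x / a))
    have e : (x, (0 : ℤ)) - (x / a) • ((a : ℤ), (0 : ℤ)) = (x % a, 0) := by
      ext <;> simp
      have := Int.mul_ediv_add_emod x a
      linarith [this, mul_comm a (x / a)]
    rwa [e] at h
  by_contra hnd
  have hr0 : x % a ≠ 0 := fun h0 => hnd (Int.dvd_of_emod_eq_zero h0)
  have hrpos : 0 < x % a := lt_of_le_of_ne (Int.emod_nonneg x (ne_of_gt ha0)) (Ne.symm hr0)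
  have hrlt : x % a < a := Int.emod_lt_of_pos x ha0
  have hmin := aPer_min g₁ g₂ (a' := (x % a).toNat) (by omega) (by
    rw [Int.toNat_of_nonneg (le_of_lt hrpos)]; exact hr)
  omega

/-- Every period has second coordinate divisible by `c`. [cite: KovalevPryadko2012, §III.C (p0005 L69-72: lattice basis change)] -/
theorem cPer_dvd {x y : ℤ} (hxy : IsPeriod g₁ g₂ (x, y)) : (cPer g₁ g₂ : ℤ) ∣ y := by
  obtain ⟨hc, -⟩ := cPer_spec g₁ g₂
  have hbc := bcPer_isPeriod g₁ g₂
  set c : ℤ := (cPer g₁ g₂ : ℤ) with hc'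
  set b : ℤ := bPer g₁ g₂ with hb'
  have hc0 : (0 : ℤ) < c := by rw [hc']; exact_mod_cast hc
  have hr : IsPeriod g₁ g₂ (x - (y / c) * b, y % c) := by
    have h := hxy.sub (hbc.zsmul (y / c))
    have e : (x, y) - (y / c) • (b, c) = (x - (y / c) * b, y % c) := by
      ext <;> simp
      have := Int.mul_ediv_add_emod y c
      linarith [this, mul_comm c (y / c)]
    rwa [e] at h
  by_contra hnd
  have hr0 : y % c ≠ 0 := fun h0 => hnd (Int.dvd_of_emod_eq_zero h0)
  have hrpos : 0 < y % c := lt_of_le_of_ne (Int.emod_nonneg y (ne_of_gt hc0)) (Ne.symm hr0)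
  have hrlt : y % c < c := Int.emod_lt_of_pos y hc0
  have hmin := cPer_min g₁ g₂ (c' := (y % c).toNat) (by omega)
    ⟨x - (y / c) * b, by rw [Int.toNat_of_nonneg (le_of_lt hrpos)]; exact hr⟩
  omega

/-- **Hermite coordinates**: every period is `(t₁ a + t₂ b, t₂ c)` for unique integers `t₁, t₂`.
[cite: KovalevPryadko2012, §III.C (p0005 L69-72: periodicity vectors form a rank-2 lattice; basis change L'ᵢ = gᵢⱼLⱼ)] -/
theorem exists_coords {m : ℤ × ℤ} (hm : IsPeriod g₁ g₂ m) :
    ∃ t₁ t₂ : ℤ, m = (t₁ * aPer g₁ g₂ + t₂ * bPer g₁ g₂, t₂ * cPer g₁ g₂) := by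
  obtain ⟨t₂, ht₂⟩ := cPer_dvd g₁ g₂ (x := m.1) (y := m.2) hm
  have h1 : IsPeriod g₁ g₂ (m.1 - t₂ * bPer g₁ g₂, 0) := by
    have h := hm.sub ((bcPer_isPeriod g₁ g₂).zsmul t₂)
    have e : m - t₂ • (bPer g₁ g₂, (cPer g₁ g₂ : ℤ)) = (m.1 - t₂ * bPer g₁ g₂, 0) := by
      ext <;> simp [ht₂, mul_comm]
    rwa [e] at h
  obtain ⟨t₁, ht₁⟩ := aPer_dvd g₁ g₂ h1
  refine ⟨t₁, t₂, ?_⟩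
  ext <;> simp
  · linarith [ht₁, mul_comm (aPer g₁ g₂ : ℤ) t₁]
  · rw [ht₂, mul_comm]

/-- Integer combinations of the Hermite basis are periods. [cite: KovalevPryadko2012, §III.C (p0005 L53-56)] -/
theorem isPeriod_coords (t₁ t₂ : ℤ) :
    IsPeriod g₁ g₂ (t₁ * aPer g₁ g₂ + t₂ * bPer g₁ g₂, t₂ * cPer g₁ g₂) := by
  have h := ((aPer_spec g₁ g₂).2.zsmul t₁).add ((bcPer_isPeriod g₁ g₂).zsmul t₂)
  have e : t₁ • ((aPer g₁ g₂ : ℤ), (0 : ℤ)) + t₂ • (bPer g₁ g₂, (cPer g₁ g₂ : ℤ))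
      = (t₁ * aPer g₁ g₂ + t₂ * bPer g₁ g₂, t₂ * cPer g₁ g₂) := by
    ext <;> simp
  rwa [e] at h

/-- **A dual functional odd on a shortest period.** For a shortest nonzero period `m` there are `w ∈ ℤ²` and
`M > 0` with `⟨w, λ⟩ ∈ Mℤ` for every period `λ` and `⟨w, m⟩ = M·t` with `t` odd (in the Hermite basis one of
the coordinates of `m` is odd, else `m/2` would be a shorter period; take `w = (c, −b)` or `(0, a)`, `M = ac`).
[cite: BombinMartinDelgado2007, §III Thm. 3.2 (p0018 L86-99: non-trivial homology classes are detected by cohomology — a non-trivial cycle pairs oddly with some cocycle)] -/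
theorem exists_odd_functional {m : ℤ × ℤ} (hm : IsPeriod g₁ g₂ m) (hm0 : m ≠ 0) (hl : l1 m = systole g₁ g₂) :
    ∃ (w : ℤ × ℤ) (M : ℤ), 0 < M ∧
      (∀ q : ℤ × ℤ, IsPeriod g₁ g₂ q → M ∣ (w.1 * q.1 + w.2 * q.2)) ∧
      ∃ t : ℤ, w.1 * m.1 + w.2 * m.2 = M * t ∧ Odd t := by
  obtain ⟨t₁, t₂, hcoord⟩ := exists_coords g₁ g₂ hm
  set a : ℤ := (aPer g₁ g₂ : ℤ) with ha'
  set b : ℤ := bPer g₁ g₂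
  set c : ℤ := (cPer g₁ g₂ : ℤ) with hc'
  have ha : (0 : ℤ) < a := by rw [ha']; exact_mod_cast (aPer_spec g₁ g₂).1
  have hc : (0 : ℤ) < c := by rw [hc']; exact_mod_cast (cPer_spec g₁ g₂).1
  -- not both coordinates even
  have hodd : Odd t₁ ∨ Odd t₂ := by
    by_contra h
    rw [not_or, Int.not_odd_iff_even, Int.not_odd_iff_even] at h
    obtain ⟨⟨s₁, hs₁⟩, ⟨s₂, hs₂⟩⟩ := h
    refine not_two_mul_of_systole hm0 hl (isPeriod_coords g₁ g₂ s₁ s₂) ?_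
    rw [hcoord, hs₁, hs₂]; ext <;> simp <;> ring
  rcases hodd with h1 | h2
  · refine ⟨(c, -b), a * c, mul_pos ha hc, ?_, t₁, ?_, h1⟩
    · intro q hq
      obtain ⟨u₁, u₂, rfl⟩ := exists_coords g₁ g₂ hq
      exact ⟨u₁, by simp; ring⟩
    · rw [hcoord]; simp; ring
  · refine ⟨(0, a), a * c, mul_pos ha hc, ?_, t₂, ?_, h2⟩
    · intro q hq
      obtain ⟨u₁, u₂, rfl⟩ := exists_coords g₁ g₂ hq
      exact ⟨u₂, by simp; ring⟩
    · rw [hcoord]; simp; ring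

end Hermite

section Cocycle

variable {G : Type*} [AddCommGroup G] [DecidableEq G] [Fintype G] {g₁ g₂ : G}

/-- The integer potential `h(p) = ⌊⟨w, p⟩/M⌋` on `ℤ²`. (definition)
[cite: BombinMartinDelgado2007, §III Thm. 3.2 (p0018 L86-99: cocycles representing H¹)] -/
def hpot (w : ℤ × ℤ) (M : ℤ) (p : ℤ × ℤ) : ℤ := (w.1 * p.1 + w.2 * p.2) / M

/-- The increment of the potential along `q` at `p`: `h(p+q) − h(p)`. (definition) [cite: BombinMartinDelgado2007, §III Thm. 3.2 (p0018 L86-99)] -/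
def dpot (w : ℤ × ℤ) (M : ℤ) (q p : ℤ × ℤ) : ℤ := hpot w M (p + q) - hpot w M p

omit [DecidableEq G] [Fintype G] in
/-- The potential shifts by the integer `⟨w,λ⟩/M` along a period. [cite: KovalevPryadko2012, §III.C (p0005 L53-56: translations by lattice vectors)] -/
theorem hpot_add_period {w : ℤ × ℤ} {M : ℤ} (hM : 0 < M)
    (hw : ∀ q : ℤ × ℤ, IsPeriod g₁ g₂ q → M ∣ (w.1 * q.1 + w.2 * q.2)) {q : ℤ × ℤ} (hq : IsPeriod g₁ g₂ q)
    (p : ℤ × ℤ) : hpot w M (p + q) = hpot w M p + (w.1 * q.1 + w.2 * q.2) / M := by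
  obtain ⟨t, ht⟩ := hw q hq
  simp only [hpot, Prod.fst_add, Prod.snd_add]
  have e : w.1 * (p.1 + q.1) + w.2 * (p.2 + q.2) = (w.1 * p.1 + w.2 * p.2) + t * M := by rw [mul_comm t M, ← ht]; ring
  rw [e, Int.add_mul_ediv_right _ _ (ne_of_gt hM), ht, Int.mul_ediv_cancel_left _ (ne_of_gt hM)]

omit [DecidableEq G] [Fintype G] in
/-- The increment is the same at two lifts of the same vertex. [cite: KovalevPryadko2012, §III.C (p0005 L53-56: the potential's coboundary is lattice-periodic)] -/
theorem dpot_eq_of_rel_eq {w : ℤ × ℤ} {M : ℤ} (hM : 0 < M)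
    (hw : ∀ q : ℤ × ℤ, IsPeriod g₁ g₂ q → M ∣ (w.1 * q.1 + w.2 * q.2)) (q : ℤ × ℤ) {p p' : ℤ × ℤ}
    (h : rel g₁ g₂ p = rel g₁ g₂ p') : dpot w M q p = dpot w M q p' := by
  have hper : IsPeriod g₁ g₂ (p' - p) := isPeriod_sub_of_rel_eq h
  have e1 : p' + q = (p + q) + (p' - p) := by abel
  have e2 : p' = p + (p' - p) := by abel
  simp only [dpot]
  rw [e1, hpot_add_period hM hw hper, e2, hpot_add_period hM hw hper, ← e2]
  ring

variable (hgen : ∀ x : G, ∃ m : ℤ × ℤ, m.1 • g₁ + m.2 • g₂ = x)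

/-- A chosen lift of a vertex of `G` to `ℤ²`. (definition) [cite: KovalevPryadko2012, §III.C (p0005 L53-56: the covering ℤ² → torus)] -/
noncomputable def lift (x : G) : ℤ × ℤ := Classical.choose (hgen x)

omit [DecidableEq G] [Fintype G] in
/-- The lift projects back: `rel (lift x) = x`. [cite: KovalevPryadko2012, §III.C (p0005 L53-56)] -/
theorem rel_lift (x : G) : rel g₁ g₂ (lift hgen x) = x := Classical.choose_spec (hgen x)

/-- **The carry cocycle** on the edges of the twisted torus: the mod-2 increment of `⌊⟨w,·⟩/M⌋` along the edge
(at any lift). (definition) [cite: BombinMartinDelgado2007, §III Thm. 3.2 (p0018 L86-99: a cocycle representing a non-trivial class of H¹ — here the «cut» dual to a period)] -/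
noncomputable def coc (w : ℤ × ℤ) (M : ℤ) : G ⊕ G → ZMod 2
  | .inl j => ((dpot w M e1 (lift hgen j) : ℤ) : ZMod 2)
  | .inr j => ((dpot w M e2 (lift hgen j) : ℤ) : ZMod 2)

variable {w : ℤ × ℤ} {M : ℤ} (hM : 0 < M) (hw : ∀ q : ℤ × ℤ, IsPeriod g₁ g₂ q → M ∣ (w.1 * q.1 + w.2 * q.2))
include hM hw

omit [DecidableEq G] [Fintype G] in
/-- `coc` on a horizontal edge, computed at any lift. [cite: BombinMartinDelgado2007, §III Thm. 3.2 (p0018 L86-99)] -/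
theorem coc_inl {j : G} {p : ℤ × ℤ} (hp : rel g₁ g₂ p = j) :
    coc hgen w M (.inl j) = ((dpot w M e1 p : ℤ) : ZMod 2) := by
  simp only [coc]
  rw [dpot_eq_of_rel_eq hM hw e1 (p := lift hgen j) (p' := p) (by rw [rel_lift, hp])]

omit [DecidableEq G] [Fintype G] in
/-- `coc` on a vertical edge, computed at any lift. [cite: BombinMartinDelgado2007, §III Thm. 3.2 (p0018 L86-99)] -/
theorem coc_inr {j : G} {p : ℤ × ℤ} (hp : rel g₁ g₂ p = j) :
    coc hgen w M (.inr j) = ((dpot w M e2 p : ℤ) : ZMod 2) := by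
  simp only [coc]
  rw [dpot_eq_of_rel_eq hM hw e2 (p := lift hgen j) (p' := p) (by rw [rel_lift, hp])]

/-- **`coc ∈ ker H_Z`**: around every plaquette the four increments of the potential cancel (a coboundary
upstairs). [cite: BombinMartinDelgado2007, §III Thm. 3.2 (p0018 L86-99: cocycles are orthogonal to all face boundaries)] -/
theorem HZ_mulVec_coc : (code g₁ g₂).HZ *ᵥ coc hgen w M = 0 := by
  funext i
  rw [code_HZ_mulVec_apply, Pi.zero_apply]
  set p := lift hgen i with hp'
  have hp : rel g₁ g₂ p = i := rel_lift hgen i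
  rw [coc_inl hgen hM hw hp, coc_inl hgen hM hw (p := p + e2) (by rw [map_add, hp, rel_unit2]),
    coc_inr hgen hM hw hp, coc_inr hgen hM hw (p := p + e1) (by rw [map_add, hp, rel_unit1])]
  simp only [dpot]
  push_cast
  have e : p + e2 + e1 = p + e1 + e2 := by abel
  rw [e]
  have h2 : ((2 : ℤ) : ZMod 2) = 0 := by decide
  linear_combination ((hpot w M (p + e1 + e2) : ZMod 2) - (hpot w M p : ZMod 2)) * h2

omit [DecidableEq G] [Fintype G] in
/-- The value of `coc` on the edge of a step is the increment of the potential along the step (mod 2).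
[cite: BombinMartinDelgado2007, §III Thm. 3.2 (p0018 L86-99)] -/
theorem coc_edge (s : Step) {v : G} {p : ℤ × ℤ} (hp : rel g₁ g₂ p = v) :
    coc hgen w M (s.edge g₁ g₂ v) = ((hpot w M (p + s.disp) - hpot w M p : ℤ) : ZMod 2) := by
  cases s with
  | hp => rw [Step.edge, coc_inl hgen hM hw hp]; rfl
  | hm =>
    rw [Step.edge, coc_inl hgen hM hw (p := p - e1) (by rw [map_sub, hp, rel_unit1])]
    have e : p + Step.hm.disp = p - e1 := by ext <;> simp [Step.disp, e1, sub_eq_add_neg]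
    rw [e, dpot, sub_add_cancel, Int.cast_sub, Int.cast_sub, CharTwo.sub_eq_add (R := ZMod 2),
      CharTwo.sub_eq_add (R := ZMod 2), add_comm]
  | vp => rw [Step.edge, coc_inr hgen hM hw hp]; rfl
  | vm =>
    rw [Step.edge, coc_inr hgen hM hw (p := p - e2) (by rw [map_sub, hp, rel_unit2])]
    have e : p + Step.vm.disp = p - e2 := by ext <;> simp [Step.disp, e2, sub_eq_add_neg]
    rw [e, dpot, sub_add_cancel, Int.cast_sub, Int.cast_sub, CharTwo.sub_eq_add (R := ZMod 2),
      CharTwo.sub_eq_add (R := ZMod 2), add_comm]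

/-- **Pairing with a walk = total increment of the potential** (telescoping):
`⟨coc, wchain v w⟩ = h(p + ndisp w) − h(p) (mod 2)` for any lift `p` of `v`.
[cite: BombinMartinDelgado2007, §III Thm. 3.2 (p0018 L86-99: the pairing of a cocycle with a cycle counts crossings)] -/
theorem coc_dotProduct_wchain :
    ∀ (ws : List Step) (v : G) (p : ℤ × ℤ), rel g₁ g₂ p = v →
      coc hgen w M ⬝ᵥ wchain g₁ g₂ v ws = ((hpot w M (p + ndisp ws) - hpot w M p : ℤ) : ZMod 2) := by
  intro ws
  induction ws with
  | nil => intro v p _; simp [ndisp]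
  | cons s t ih =>
    intro v p hp
    rw [wchain_cons, dotProduct_add, dotProduct_single, mul_one, coc_edge hgen hM hw s hp,
      ih (s.move g₁ g₂ v) (p + s.disp) (by rw [map_add, hp, Step.move_eq_add_rel]), ndisp, ← add_assoc]
    push_cast; ring

end Cocycle

/-! ## The distance -/

section Distance

variable {G : Type*} [AddCommGroup G] [DecidableEq G] [Fintype G] {g₁ g₂ : G}

/-- **Upper-bound witness**: under generation, the staircase loop at `0` of a shortest period is a `Z`-logical
(a cycle, not a stabilizer) of weight exactly `sys₁(Λ)`.
[cite: KovalevPryadko2012, §III.C (p0005 L72-77: the shortest topologically non-trivial chain realises a period L with ‖L‖ operators)] -/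
theorem exists_zLogical_weight_systole (hgen : ∀ x : G, ∃ m : ℤ × ℤ, m.1 • g₁ + m.2 • g₂ = x) :
    ∃ z : G ⊕ G → ZMod 2, (code g₁ g₂).HX *ᵥ z = 0 ∧ z ∉ (code g₁ g₂).rowSpZ ∧ hammingNorm z = systole g₁ g₂ := by
  obtain ⟨m, hm, hm0, hl⟩ := systole_spec g₁ g₂
  obtain ⟨w, M, hM, hw, t, ht, hodd⟩ := exists_odd_functional g₁ g₂ hm hm0 hl
  set z := wchain g₁ g₂ (0 : G) (stair m) with hz
  have hcyc : (code g₁ g₂).HX *ᵥ z = 0 := by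
    rw [code_HX_mulVec]; funext i
    exact star_wchain_of_closed g₁ g₂ (endPos_stair_of_isPeriod hm 0) i
  have hpair : coc hgen w M ⬝ᵥ z = 1 := by
    rw [hz, coc_dotProduct_wchain hgen hM hw (stair m) 0 0 (map_zero _), ndisp_stair, zero_add]
    have h0 : hpot w M 0 = 0 := by simp [hpot]
    rw [h0, sub_zero, hpot, ht, Int.mul_ediv_cancel_left _ (ne_of_gt hM), CharTwo.intCast_eq_ite,
      if_neg (Int.not_even_iff_odd.2 hodd)]
  have hlog : z ∉ (code g₁ g₂).rowSpZ :=
    not_mem_rowSpace_of_witness (coc hgen w M) (HZ_mulVec_coc hgen hM hw) (by rw [hpair]; exact one_ne_zero)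
  refine ⟨z, hcyc, hlog, le_antisymm ?_ (systole_le_hammingNorm_of_zLogical g₁ g₂ z hcyc hlog)⟩
  calc hammingNorm z ≤ (stair m).length := hammingNorm_wchain_le g₁ g₂ 0 (stair m)
    _ = systole g₁ g₂ := by rw [length_stair, hl]

/-- **`d_Z = sys₁(Λ)`** for the twisted toric code of `(G; g₁, g₂)`, generation in the form `∀ x, ∃ m, m₁•g₁ + m₂•g₂ = x`.
[cite: KovalevPryadko2012, §III.C (p0005 L74-77: d(L₁,L₂) = min_{m₁,m₂} ‖m₁L₁ + m₂L₂‖)] -/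
theorem code_dZ_of_gen (hgen : ∀ x : G, ∃ m : ℤ × ℤ, m.1 • g₁ + m.2 • g₂ = x) : (code g₁ g₂).dZ = systole g₁ g₂ := by
  obtain ⟨z, hz, hz', hwt⟩ := exists_zLogical_weight_systole hgen
  exact (code g₁ g₂).dZ_eq_of_witness hz hz' hwt (systole_le_hammingNorm_of_zLogical g₁ g₂)

/-- **`d_X = sys₁(Λ)`** (the `X ↔ Z` symmetry of abelian two-block codes, tree `css_dX_eq_dZ`), generation in `∃`-form.
[cite: KovalevPryadko2012, §III.C (p0005 L74-77)] -/
theorem code_dX_of_gen (hgen : ∀ x : G, ∃ m : ℤ × ℤ, m.1 • g₁ + m.2 • g₂ = x) : (code g₁ g₂).dX = systole g₁ g₂ := by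
  rw [← code_dZ_of_gen hgen]; exact AbelianTwoBlock.css_dX_eq_dZ _ _

/-- **Main theorem, `∃`-form of generation: the toric code on the twisted torus is `[[2|G|, 2, sys₁(Λ)]]`.**
[cite: KovalevPryadko2012, §III.C (p0005 L52-80: n = |L₁ × L₂|, k = 2, d(L₁,L₂) = min_{m₁,m₂} ‖m₁L₁ + m₂L₂‖ — «it is easy to see», no printed proof)] [cite: BombinMartinDelgado2007, §III Thm. 3.2 (p0018 L86-99: d = d(Σ), proved L101-118)] -/
theorem code_isCode_of_gen (hgen : ∀ x : G, ∃ m : ℤ × ℤ, m.1 • g₁ + m.2 • g₂ = x) :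
    (code g₁ g₂).IsCode (2 * Fintype.card G) 2 (systole g₁ g₂) := by
  have hk := code_k_eq_two hgen
  have h := (code g₁ g₂).isCode_of_dX_dZ (by rw [hk]; exact two_pos) (code_dX_of_gen hgen) (code_dZ_of_gen hgen)
  rwa [card_qubits, hk, min_self] at h

/-- **`d_Z = sys₁(Λ)`** for the twisted toric code of `(G; g₁, g₂)` with `⟨g₁, g₂⟩ = G`.
[cite: KovalevPryadko2012, §III.C (p0005 L74-77: d(L₁,L₂) = min_{m₁,m₂} ‖m₁L₁ + m₂L₂‖)] -/
theorem code_dZ (hgen : AddSubgroup.closure ({g₁, g₂} : Set G) = ⊤) : (code g₁ g₂).dZ = systole g₁ g₂ :=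
  code_dZ_of_gen (gen_of_closure_eq_top hgen)

/-- **`d_X = sys₁(Λ)`** with `⟨g₁, g₂⟩ = G`. [cite: KovalevPryadko2012, §III.C (p0005 L74-77)] -/
theorem code_dX (hgen : AddSubgroup.closure ({g₁, g₂} : Set G) = ⊤) : (code g₁ g₂).dX = systole g₁ g₂ :=
  code_dX_of_gen (gen_of_closure_eq_top hgen)

/-- **Main theorem: the toric code on the twisted torus `ℤ²/Λ` is `[[2|G|, 2, sys₁(Λ)]]`.** For every finite
abelian group `G` generated by `g₁, g₂`, `LP[1 + x^{g₁}, 1 + x^{g₂}]` has `2|G|` qubits, `2` logical qubits and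
distance the L¹ systole of the period lattice `{m : m₁•g₁ + m₂•g₂ = 0}`.
[cite: KovalevPryadko2012, §III.C (p0005 L52-80: n = |L₁ × L₂|, k = 2, d(L₁,L₂) = min_{m₁,m₂} ‖m₁L₁ + m₂L₂‖ — «it is easy to see», no printed proof)] [cite: BombinMartinDelgado2007, §III Thm. 3.2 (p0018 L86-99: d = d(Σ), proved L101-118)] -/
theorem code_isCode (hgen : AddSubgroup.closure ({g₁, g₂} : Set G) = ⊤) :
    (code g₁ g₂).IsCode (2 * Fintype.card G) 2 (systole g₁ g₂) :=
  code_isCode_of_gen (gen_of_closure_eq_top hgen)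

/-- **Correction radius of every twisted toric code, attained**: minimum-weight decoding of the star syndrome
corrects every phase-flip pattern of weight `≤ ⌊(sys₁(Λ) − 1)/2⌋`, and minimum-weight decoding of the plaquette
syndrome every bit-flip pattern of that weight (tree `IsCode.minWeight_correctsUpToZ/X`).
[cite: KovalevPryadko2012, §III.C (p0005 L74-77)] [cite: BombinMartinDelgado2007, §III Thm. 3.2 (p0018 L86-99)] -/
theorem code_minWeight_correctsUpTo (hgen : AddSubgroup.closure ({g₁, g₂} : Set G) = ⊤) :
    (Decoder.minWeight (code g₁ g₂).zSyndrome hammingNorm).CorrectsUpTo (code g₁ g₂).zSyndrome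
        ((code g₁ g₂).rowSpZ : Set (G ⊕ G → ZMod 2)) hammingNorm ((systole g₁ g₂ - 1) / 2) ∧
      (Decoder.minWeight (code g₁ g₂).xSyndrome hammingNorm).CorrectsUpTo (code g₁ g₂).xSyndrome
        ((code g₁ g₂).rowSpX : Set (G ⊕ G → ZMod 2)) hammingNorm ((systole g₁ g₂ - 1) / 2) :=
  ⟨(code_isCode hgen).minWeight_correctsUpToZ, (code_isCode hgen).minWeight_correctsUpToX⟩

/-- **… and optimal**: no pair of sector decoders of a twisted toric code corrects every pattern of weight `≤ t` in
both sectors unless `t ≤ ⌊(sys₁(Λ) − 1)/2⌋` (tree `IsCode.le_half_of_correctsUpTo_sectors`).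
[cite: KovalevPryadko2012, §III.C (p0005 L74-77)] [cite: BombinMartinDelgado2007, §III Thm. 3.2 (p0018 L86-99)] -/
theorem code_radius_optimal (hgen : AddSubgroup.closure ({g₁, g₂} : Set G) = ⊤)
    {DX : Decoder (G → ZMod 2) (G ⊕ G → ZMod 2)} {DZ : Decoder (G → ZMod 2) (G ⊕ G → ZMod 2)} {t : ℕ}
    (hDX : DX.CorrectsUpTo (code g₁ g₂).xSyndrome ((code g₁ g₂).rowSpX : Set (G ⊕ G → ZMod 2)) hammingNorm t)
    (hDZ : DZ.CorrectsUpTo (code g₁ g₂).zSyndrome ((code g₁ g₂).rowSpZ : Set (G ⊕ G → ZMod 2)) hammingNorm t) :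
    t ≤ (systole g₁ g₂ - 1) / 2 :=
  (code_isCode hgen).le_half_of_correctsUpTo_sectors hDX hDZ

end Distance

end TwistedToric

end Literature.InformationTheory.QuantumCodes
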